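import Summits.CriticalPhenomena.PercolationContinuityZ3.Theorems.PercNearOneGluingNoHeavyLowerTailThreePartitionVOrder

/-!
# Conjecture V on PRINCIPAL up-sets: the `E₃` face kernel summed over all subfaces of any face of the cube is `≥ 0`
# — for ALL pairs of up-sets, indeed for all nonnegative increasing weights (THEOREM P)

Support file (lineage `prim-bnk-2`, generation 33; `--supports stmt-CriticalPhenomena-4575`; memo
`run/shared/lean/prim/prim-l12/FROM-prim-bnk-2-g33-CONJ-W.md` §3).  No `sorry`, no new definitions, standard axioms.

The kernel of Conjecture V (`VOrderPositivity`, file `…ThreePartitionVOrder`; untwisted) at a face `(x | y | z)` of the cube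
(`x` = `+`-coordinates, `y` = `−`-coordinates, `z` = free coordinates) is
`K_{b,c}(x,y,z) = 2 b(x) c(x) + b(z) c(y) − c(x) b(z) − b(x) c(z) − b(z) c(z)`, `b = 1_𝒱`, `c = 1_𝒲`.
Conjecture V asks `Σ_{F ∈ 𝒳} K(F) ≥ 0` for every family `𝒳` of faces closed under passing to subfaces.  THEOREM P (this file)
settles the PRINCIPAL families `𝒳 = {subfaces of F₀}`, `F₀ = (x₀ | y₀ | z₀)`: the subfaces are `(x₀ ∪ g | y₀ ∪ h | w)` for the
ordered 3-partitions `(g,h,w)` of `z₀`, and for ALL nonnegative increasing `b, c : Finset ι → ℤ`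
  `Σ_{(g,h,w) ⊢ z₀} K_{b,c}(x₀ ∪ g, y₀ ∪ h, w) ≥ 0`      (`principal_kernel_sum_nonneg`).
PROOF (memo §3b–c).  `K = α + β` with `α = b(x)c(x) − b(z)c(z)` and `β = (b(x) − b(z))(c(x) − c(z)) + b(z)(c(y) − c(z))`.
Both partition sums satisfy exact recursions in `z₀` ("slicing at a free coordinate `e`", the tensor identities
`M = M′ ⊗ W + (2D_X − D_Z) ⊗ Δ_e` of the memo): with `b₁ := b ∘ insert e`, `c₁ := c ∘ insert e`,
  `Σ^{z₀+e} α[b,c] = Σ^{z₀} α[b₁,c₁] + 2 Σ^{z₀} α[b,c]`,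
  `Σ^{z₀+e} β[b,c] = Σ^{z₀} (β[b,c] + β[b,c₁] + β[b₁,c]) + Σ^{z₀} (b₁ − b)(x₀∪g)·(c₁ − c)(x₀∪g)`   (TERMWISE identities),
and the base sums `α = b(x₀)c(x₀) − b(∅)c(∅)`, `β = (b(x₀)−b(∅))(c(x₀)−c(∅)) + b(∅)(c(y₀)−c(∅))` are `≥ 0`; induction.
The same identities give an explicit certificate that the coefficient matrix of a principal family lies in the cone
`USN ⊗ USN` of Conjecture W (memo §3b).  For `x₀ = A`-generator, `y₀ = ∅` this is the comb coefficient of a principal filter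
`A = ↑x₀` (all-increasing profile), nonnegative for all up-sets `𝒱, 𝒲`. [this work]
-/

namespace Summit.CriticalPhenomena.PercolationContinuityZ3.Theorems.ThreePartition

open Finset

variable {ι : Type*} [DecidableEq ι]

/-! ## Slicing a partition sum at a free coordinate -/

/-- **Slicing identity.**  A sum over the ordered 3-partitions `(g, h, w)` of `insert e z₀` (`e ∉ z₀`), written as a double
sum over `g ⊆ insert e z₀`, `h ⊆ (insert e z₀) \ g` with `w` the rest, is the sum over the 3-partitions of `z₀` of the three
placements of `e`. [this work] -/
theorem sum_threePartitions_insert {e : ι} {z₀ : Finset ι} (he : e ∉ z₀) (T : Finset ι → Finset ι → Finset ι → ℤ) :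
    ∑ g ∈ (insert e z₀).powerset, ∑ h ∈ (insert e z₀ \ g).powerset, T g h ((insert e z₀ \ g) \ h) =
      ∑ g ∈ z₀.powerset, ∑ h ∈ (z₀ \ g).powerset,
        (T (insert e g) h ((z₀ \ g) \ h) + T g (insert e h) ((z₀ \ g) \ h) + T g h (insert e ((z₀ \ g) \ h))) := by
  rw [Finset.sum_powerset_insert he]
  have h1 : ∀ g ∈ z₀.powerset, ∑ h ∈ (insert e z₀ \ g).powerset, T g h ((insert e z₀ \ g) \ h) =
      ∑ h ∈ (z₀ \ g).powerset, (T g h (insert e ((z₀ \ g) \ h)) + T g (insert e h) ((z₀ \ g) \ h)) := by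
    intro g hg
    have heg : e ∉ g := fun h => he (Finset.mem_powerset.1 hg h)
    have hezg : e ∉ z₀ \ g := fun h => he (Finset.mem_sdiff.1 h).1
    rw [Finset.insert_sdiff_of_notMem z₀ heg, Finset.sum_powerset_insert hezg, ← Finset.sum_add_distrib]
    refine Finset.sum_congr rfl fun h hh => ?_
    have heh : e ∉ h := fun h' => hezg (Finset.mem_powerset.1 hh h')
    rw [Finset.insert_sdiff_of_notMem _ heh, Finset.insert_sdiff_insert, Finset.sdiff_insert_of_notMem hezg]
  have h2 : ∀ g ∈ z₀.powerset, ∑ h ∈ (insert e z₀ \ insert e g).powerset, T (insert e g) h ((insert e z₀ \ insert e g) \ h) =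
      ∑ h ∈ (z₀ \ g).powerset, T (insert e g) h ((z₀ \ g) \ h) := by
    intro g _
    rw [Finset.insert_sdiff_insert, Finset.sdiff_insert_of_notMem he]
  rw [Finset.sum_congr rfl h1, Finset.sum_congr rfl h2, ← Finset.sum_add_distrib]
  refine Finset.sum_congr rfl fun g _ => ?_
  rw [← Finset.sum_add_distrib]
  refine Finset.sum_congr rfl fun h _ => ?_
  ring

/-! ## The `α`-part: `b(x)c(x) − b(z)c(z)` -/

/-- **`α`-part.**  For nonnegative increasing `b, c` and any `x₀`:
`Σ_{(g,h,w) ⊢ z₀} (b(x₀∪g) c(x₀∪g) − b(w) c(w)) ≥ 0`.  (Recursion `Σ^{z₀+e} α[b,c] = Σ^{z₀} α[b∘insert e, c∘insert e] + 2Σ^{z₀} α[b,c]`;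
base `b(x₀)c(x₀) ≥ b(∅)c(∅)`.) [this work] -/
theorem principal_alpha_sum_nonneg (z₀ : Finset ι) :
    ∀ (b c : Finset ι → ℤ), (∀ S, 0 ≤ b S) → (∀ S, 0 ≤ c S) → Monotone b → Monotone c → ∀ (x₀ : Finset ι),
      0 ≤ ∑ g ∈ z₀.powerset, ∑ h ∈ (z₀ \ g).powerset, (b (x₀ ∪ g) * c (x₀ ∪ g) - b ((z₀ \ g) \ h) * c ((z₀ \ g) \ h)) := by
  induction z₀ using Finset.induction_on with
  | empty =>
    intro b c hb0 hc0 hb hc x₀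
    simp only [Finset.powerset_empty, Finset.sum_singleton, Finset.empty_sdiff, Finset.union_empty]
    have h1 : b ∅ ≤ b x₀ := hb (Finset.empty_subset _)
    have h2 : c ∅ ≤ c x₀ := hc (Finset.empty_subset _)
    nlinarith [hb0 ∅, hc0 ∅, mul_le_mul h1 h2 (hc0 ∅) (hb0 x₀)]
  | insert e z₀ he ih =>
    intro b c hb0 hc0 hb hc x₀
    have h3 := sum_threePartitions_insert he (fun g h w => b (x₀ ∪ g) * c (x₀ ∪ g) - b w * c w)
    rw [h3]
    have hb1 : Monotone (fun S => b (insert e S)) := fun S T hST => hb (Finset.insert_subset_insert e hST)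
    have hc1 : Monotone (fun S => c (insert e S)) := fun S T hST => hc (Finset.insert_subset_insert e hST)
    have key := ih (fun S => b (insert e S)) (fun S => c (insert e S)) (fun S => hb0 _) (fun S => hc0 _) hb1 hc1 x₀
    have key2 := ih b c hb0 hc0 hb hc x₀
    have hsplit : ∑ g ∈ z₀.powerset, ∑ h ∈ (z₀ \ g).powerset,
        (b (x₀ ∪ insert e g) * c (x₀ ∪ insert e g) - b ((z₀ \ g) \ h) * c ((z₀ \ g) \ h) +
          (b (x₀ ∪ g) * c (x₀ ∪ g) - b ((z₀ \ g) \ h) * c ((z₀ \ g) \ h)) +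
          (b (x₀ ∪ g) * c (x₀ ∪ g) - b (insert e ((z₀ \ g) \ h)) * c (insert e ((z₀ \ g) \ h)))) =
        (∑ g ∈ z₀.powerset, ∑ h ∈ (z₀ \ g).powerset,
          (b (insert e (x₀ ∪ g)) * c (insert e (x₀ ∪ g)) - b (insert e ((z₀ \ g) \ h)) * c (insert e ((z₀ \ g) \ h)))) +
        2 * ∑ g ∈ z₀.powerset, ∑ h ∈ (z₀ \ g).powerset,
          (b (x₀ ∪ g) * c (x₀ ∪ g) - b ((z₀ \ g) \ h) * c ((z₀ \ g) \ h)) := by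
      rw [Finset.mul_sum, ← Finset.sum_add_distrib]
      refine Finset.sum_congr rfl fun g _ => ?_
      rw [Finset.mul_sum, ← Finset.sum_add_distrib]
      refine Finset.sum_congr rfl fun h _ => ?_
      rw [Finset.union_insert]
      ring
    rw [hsplit]
    nlinarith [key, key2]

/-! ## The `β`-part: `(b(x) − b(z))(c(x) − c(z)) + b(z)(c(y) − c(z))` -/

/-- **`β`-part.**  For nonnegative increasing `b, c` and any `x₀, y₀`:
`Σ_{(g,h,w) ⊢ z₀} ((b(x₀∪g) − b(w))(c(x₀∪g) − c(w)) + b(w)(c(y₀∪h) − c(w))) ≥ 0`.  (Termwise slicing identity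
`Σ_{e-placements} β[b,c] = β[b,c] + β[b,c∘insert e] + β[b∘insert e,c] + (b(x₀∪g+e) − b(x₀∪g))(c(x₀∪g+e) − c(x₀∪g))`;
base `(b(x₀)−b(∅))(c(x₀)−c(∅)) + b(∅)(c(y₀)−c(∅)) ≥ 0`.) [this work] -/
theorem principal_beta_sum_nonneg (z₀ : Finset ι) :
    ∀ (b c : Finset ι → ℤ), (∀ S, 0 ≤ b S) → (∀ S, 0 ≤ c S) → Monotone b → Monotone c → ∀ (x₀ y₀ : Finset ι),
      0 ≤ ∑ g ∈ z₀.powerset, ∑ h ∈ (z₀ \ g).powerset,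
        ((b (x₀ ∪ g) - b ((z₀ \ g) \ h)) * (c (x₀ ∪ g) - c ((z₀ \ g) \ h)) +
          b ((z₀ \ g) \ h) * (c (y₀ ∪ h) - c ((z₀ \ g) \ h))) := by
  induction z₀ using Finset.induction_on with
  | empty =>
    intro b c hb0 hc0 hb hc x₀ y₀
    simp only [Finset.powerset_empty, Finset.sum_singleton, Finset.empty_sdiff, Finset.union_empty]
    have h1 : b ∅ ≤ b x₀ := hb (Finset.empty_subset _)
    have h2 : c ∅ ≤ c x₀ := hc (Finset.empty_subset _)
    have h3 : c ∅ ≤ c y₀ := hc (Finset.empty_subset _)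
    nlinarith [hb0 ∅, mul_nonneg (sub_nonneg.2 h1) (sub_nonneg.2 h2), mul_nonneg (hb0 ∅) (sub_nonneg.2 h3)]
  | insert e z₀ he ih =>
    intro b c hb0 hc0 hb hc x₀ y₀
    have h3 := sum_threePartitions_insert he
      (fun g h w => (b (x₀ ∪ g) - b w) * (c (x₀ ∪ g) - c w) + b w * (c (y₀ ∪ h) - c w))
    rw [h3]
    have hb1 : Monotone (fun S => b (insert e S)) := fun S T hST => hb (Finset.insert_subset_insert e hST)
    have hc1 : Monotone (fun S => c (insert e S)) := fun S T hST => hc (Finset.insert_subset_insert e hST)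
    have k00 := ih b c hb0 hc0 hb hc x₀ y₀
    have k01 := ih b (fun S => c (insert e S)) hb0 (fun S => hc0 _) hb hc1 x₀ y₀
    have k10 := ih (fun S => b (insert e S)) c (fun S => hb0 _) hc0 hb1 hc x₀ y₀
    -- the square term is termwise nonnegative
    have ksq : 0 ≤ ∑ g ∈ z₀.powerset, ∑ h ∈ (z₀ \ g).powerset,
        (b (insert e (x₀ ∪ g)) - b (x₀ ∪ g)) * (c (insert e (x₀ ∪ g)) - c (x₀ ∪ g)) := by
      refine Finset.sum_nonneg fun g _ => Finset.sum_nonneg fun h _ => mul_nonneg ?_ ?_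
      · exact sub_nonneg.2 (hb (Finset.subset_insert e _))
      · exact sub_nonneg.2 (hc (Finset.subset_insert e _))
    -- termwise slicing identity
    have hsplit : ∑ g ∈ z₀.powerset, ∑ h ∈ (z₀ \ g).powerset,
        ((b (x₀ ∪ insert e g) - b ((z₀ \ g) \ h)) * (c (x₀ ∪ insert e g) - c ((z₀ \ g) \ h)) +
            b ((z₀ \ g) \ h) * (c (y₀ ∪ h) - c ((z₀ \ g) \ h)) +
          ((b (x₀ ∪ g) - b ((z₀ \ g) \ h)) * (c (x₀ ∪ g) - c ((z₀ \ g) \ h)) +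
            b ((z₀ \ g) \ h) * (c (y₀ ∪ insert e h) - c ((z₀ \ g) \ h))) +
          ((b (x₀ ∪ g) - b (insert e ((z₀ \ g) \ h))) * (c (x₀ ∪ g) - c (insert e ((z₀ \ g) \ h))) +
            b (insert e ((z₀ \ g) \ h)) * (c (y₀ ∪ h) - c (insert e ((z₀ \ g) \ h))))) =
        (∑ g ∈ z₀.powerset, ∑ h ∈ (z₀ \ g).powerset,
          ((b (x₀ ∪ g) - b ((z₀ \ g) \ h)) * (c (x₀ ∪ g) - c ((z₀ \ g) \ h)) +
            b ((z₀ \ g) \ h) * (c (y₀ ∪ h) - c ((z₀ \ g) \ h)))) +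
        (∑ g ∈ z₀.powerset, ∑ h ∈ (z₀ \ g).powerset,
          ((b (x₀ ∪ g) - b ((z₀ \ g) \ h)) * (c (insert e (x₀ ∪ g)) - c (insert e ((z₀ \ g) \ h))) +
            b ((z₀ \ g) \ h) * (c (insert e (y₀ ∪ h)) - c (insert e ((z₀ \ g) \ h))))) +
        (∑ g ∈ z₀.powerset, ∑ h ∈ (z₀ \ g).powerset,
          ((b (insert e (x₀ ∪ g)) - b (insert e ((z₀ \ g) \ h))) * (c (x₀ ∪ g) - c ((z₀ \ g) \ h)) +
            b (insert e ((z₀ \ g) \ h)) * (c (y₀ ∪ h) - c ((z₀ \ g) \ h)))) +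
        ∑ g ∈ z₀.powerset, ∑ h ∈ (z₀ \ g).powerset,
          (b (insert e (x₀ ∪ g)) - b (x₀ ∪ g)) * (c (insert e (x₀ ∪ g)) - c (x₀ ∪ g)) := by
      rw [← Finset.sum_add_distrib, ← Finset.sum_add_distrib, ← Finset.sum_add_distrib]
      refine Finset.sum_congr rfl fun g _ => ?_
      rw [← Finset.sum_add_distrib, ← Finset.sum_add_distrib, ← Finset.sum_add_distrib]
      refine Finset.sum_congr rfl fun h _ => ?_
      rw [Finset.union_insert, Finset.union_insert]
      ring
    rw [hsplit]
    nlinarith [k00, k01, k10, ksq]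

/-! ## THEOREM P -/

/-- **THEOREM P (Conjecture V on principal up-sets, for all weights).**  For nonnegative increasing
`b, c : Finset ι → ℤ` and any `x₀, y₀, z₀`, the `E₃` face kernel
`K_{b,c}(x,y,z) = 2b(x)c(x) + b(z)c(y) − c(x)b(z) − b(x)c(z) − b(z)c(z)` summed over the faces `(x₀ ∪ g | y₀ ∪ h | w)`,
`(g,h,w)` the ordered 3-partitions of `z₀` — i.e. over all subfaces of the face `(x₀ | y₀ | z₀)` when `x₀, y₀, z₀` are
disjoint — is `≥ 0`.  With `b = 1_𝒱`, `c = 1_𝒲` this is `Σ_{F ≥ F₀} K_{𝒱,𝒲}(F) ≥ 0`, Conjecture V (`VOrderPositivity`,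
untwisted) restricted to the principal up-sets `↑F₀` of the copy order, for ALL up-sets `𝒱, 𝒲`. [this work] -/
theorem principal_kernel_sum_nonneg (b c : Finset ι → ℤ) (hb0 : ∀ S, 0 ≤ b S) (hc0 : ∀ S, 0 ≤ c S)
    (hb : Monotone b) (hc : Monotone c) (x₀ y₀ z₀ : Finset ι) :
    0 ≤ ∑ g ∈ z₀.powerset, ∑ h ∈ (z₀ \ g).powerset,
      (2 * b (x₀ ∪ g) * c (x₀ ∪ g) + b ((z₀ \ g) \ h) * c (y₀ ∪ h) - c (x₀ ∪ g) * b ((z₀ \ g) \ h)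
        - b (x₀ ∪ g) * c ((z₀ \ g) \ h) - b ((z₀ \ g) \ h) * c ((z₀ \ g) \ h)) := by
  have hA := principal_alpha_sum_nonneg z₀ b c hb0 hc0 hb hc x₀
  have hB := principal_beta_sum_nonneg z₀ b c hb0 hc0 hb hc x₀ y₀
  have hsplit : ∑ g ∈ z₀.powerset, ∑ h ∈ (z₀ \ g).powerset,
      (2 * b (x₀ ∪ g) * c (x₀ ∪ g) + b ((z₀ \ g) \ h) * c (y₀ ∪ h) - c (x₀ ∪ g) * b ((z₀ \ g) \ h)
        - b (x₀ ∪ g) * c ((z₀ \ g) \ h) - b ((z₀ \ g) \ h) * c ((z₀ \ g) \ h)) =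
      (∑ g ∈ z₀.powerset, ∑ h ∈ (z₀ \ g).powerset,
        (b (x₀ ∪ g) * c (x₀ ∪ g) - b ((z₀ \ g) \ h) * c ((z₀ \ g) \ h))) +
      ∑ g ∈ z₀.powerset, ∑ h ∈ (z₀ \ g).powerset,
        ((b (x₀ ∪ g) - b ((z₀ \ g) \ h)) * (c (x₀ ∪ g) - c ((z₀ \ g) \ h)) +
          b ((z₀ \ g) \ h) * (c (y₀ ∪ h) - c ((z₀ \ g) \ h))) := by
    rw [← Finset.sum_add_distrib]
    refine Finset.sum_congr rfl fun g _ => ?_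
    rw [← Finset.sum_add_distrib]
    refine Finset.sum_congr rfl fun h _ => ?_
    ring
  rw [hsplit]
  exact add_nonneg hA hB

/-- **THEOREM P for up-sets** (`b = 1_𝒱`, `c = 1_𝒲`, families of finsets closed upward): Conjecture V's kernel summed over all
subfaces of any face is `≥ 0`. [this work] -/
theorem principal_kernel_sum_nonneg_of_upsets (𝒱 𝒲 : Finset (Finset ι))
    (h𝒱 : ∀ S ∈ 𝒱, ∀ T, S ⊆ T → T ∈ 𝒱) (h𝒲 : ∀ S ∈ 𝒲, ∀ T, S ⊆ T → T ∈ 𝒲) (x₀ y₀ z₀ : Finset ι) :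
    0 ≤ ∑ g ∈ z₀.powerset, ∑ h ∈ (z₀ \ g).powerset,
      (2 * (if x₀ ∪ g ∈ 𝒱 then (1 : ℤ) else 0) * (if x₀ ∪ g ∈ 𝒲 then (1 : ℤ) else 0)
        + (if (z₀ \ g) \ h ∈ 𝒱 then (1 : ℤ) else 0) * (if y₀ ∪ h ∈ 𝒲 then (1 : ℤ) else 0)
        - (if x₀ ∪ g ∈ 𝒲 then (1 : ℤ) else 0) * (if (z₀ \ g) \ h ∈ 𝒱 then (1 : ℤ) else 0)
        - (if x₀ ∪ g ∈ 𝒱 then (1 : ℤ) else 0) * (if (z₀ \ g) \ h ∈ 𝒲 then (1 : ℤ) else 0)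
        - (if (z₀ \ g) \ h ∈ 𝒱 then (1 : ℤ) else 0) * (if (z₀ \ g) \ h ∈ 𝒲 then (1 : ℤ) else 0)) := by
  have hbm : Monotone (fun S : Finset ι => if S ∈ 𝒱 then (1 : ℤ) else 0) := by
    intro S T hST
    simp only
    by_cases hS : S ∈ 𝒱
    · rw [if_pos hS, if_pos (h𝒱 S hS T hST)]
    · rw [if_neg hS]; split_ifs <;> norm_num
  have hcm : Monotone (fun S : Finset ι => if S ∈ 𝒲 then (1 : ℤ) else 0) := by
    intro S T hST
    simp only
    by_cases hS : S ∈ 𝒲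
    · rw [if_pos hS, if_pos (h𝒲 S hS T hST)]
    · rw [if_neg hS]; split_ifs <;> norm_num
  have h := principal_kernel_sum_nonneg (fun S => if S ∈ 𝒱 then (1 : ℤ) else 0) (fun S => if S ∈ 𝒲 then (1 : ℤ) else 0)
    (fun S => by split_ifs <;> norm_num) (fun S => by split_ifs <;> norm_num) hbm hcm x₀ y₀ z₀
  exact h

end Summit.CriticalPhenomena.PercolationContinuityZ3.Theorems.ThreePartition
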